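import Summits.ValiantsHypothesis.ValiantsHypothesis.Theorems.GrenetZeonDualUnipotentThreeHalvesHeavyTopIndexCore
import Summits.ValiantsHypothesis.ValiantsHypothesis.Theorems.GrenetZeonDualUnipotentThreeHalvesHeavyTopInvariantFlag
import Summits.ValiantsHypothesis.ValiantsHypothesis.Theorems.GrenetZeonDualUnipotentThreeHalvesHeavyTopNecklace

/-!
# `GrenetZeon.DualUnipotentThreeHalves` (stmt-ValiantsHypothesis-24318) — the BLOCK INDEX-CORE certificate
(val-idea-26 g5, MEMO-g5-index-sandwich §4.2; instrument for the successor skeleton's RED glue, director-valiant R306 (3))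

One certificate containing BOTH ✓ G-core `HeavyTopInvariantFlag.flagCheap_of_block_levels` (the case `a = 1`) and
✓ ★ `IndexCore.flagCheap_of_indexCore` (the case `p = 1`).

Setting.  After a constant change of basis `g` the whole affine pencil `N` is BLOCK LOWER for a level function
`lvl : Fin m → ℕ` with `p` levels (`(g N g⁻¹)_{ij} = 0` whenever `lvl i < lvl j`, the hypothesis shape of G-core), and
`K` is a direction space such that for `v ∈ K` the DIAGONAL BLOCKS of the `a`-th power of the conjugated top
`(g N_lin(v) g⁻¹)^a` vanish — i.e. every diagonal block of the top has nilindex `≤ a` (for `a = 1`: the diagonal blocks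
of the top itself vanish, G-core's `K`).  Inside a block the top may stay ALIVE on an index-`a` core.

* `pow_apply_eq_zero_of_diag_pow` — then `g Q g⁻¹ =: Q'` satisfies `(Q'^(a(t+1)))_{ij} = 0` whenever `lvl i ≤ lvl j + t`
  (`Q'^a` is STRICTLY block lower).
* `count_le_of_block` — the word invariant generalising ✓ `IndexCore.count_true_add_le_of_pow_eq_zero`:
  `(Q'^u · word)_{ij} ≠ 0 ⇒ #top + u + #const + 1 ≤ a·(#const + (lvl i − lvl j) + 1)`.
* `wordTame_of_block` — hence every pair `(const, top)` is word-tame with profile `c = 1, r = a − 1, Θ = a·p − 1`,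
  budget `k = ⌊(a·p − 1 + (a−1)(n−1))/a⌋` (`= p − 1` for `a = 1`, `= ⌊(a−1)n/a⌋` for `p = 1`).
* `flagCheap_of_block_indexCores` — `((k+1)·n < dim K) ⇒ FlagCheap n m N` (✓ `flagCheap_iff_wordCheap`).
* `indexNec_of_flagCheap` (rev 2, memo §1) — the NECESSARY half of the index sandwich BY NAME (= ✓ p613488
  `FlagCheapIndexBound.linPart_pow_eq_zero_of_flagCheap` over the named predicates): `FlagCheap n m N ⇒ ∃ K a, 1 ≤ a ∧
  (∀ v ∈ K, N_lin(v)^a = 0) ∧ a·n < dim K`.  So ✓ ★ and p613488 SANDWICH `FlagCheap` between two index statements (flag currency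
  only; in power currency the necessary half is lost, memo §2).

Reading (memo §4.3): the «reset tax» `(a−1)n²/a` is paid ONCE globally, the «level tax» is `p·n`; a constituent whose
whole top block has index `≤ a` is free; the certificate dies exactly on a LONG IRREDUCIBLE constituent (IRR's enemy).
Honest framing: an instrument (sufficient certificate), no law; nothing here proves or refutes `HeavyTopLaw`,
`HeavyTopSlowLaw`, 24318, S3b or 8062; `VP ≠ VNP` is NOT proved; no summit statement is touched.  No definitions,
no named facts, no sorry. [folklore block bookkeeping + val-idea-26 g3/g5]
-/

noncomputable section

-- single-conjunct layout: Sub = Summit, duplicated namespace component intended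
set_option linter.dupNamespace false

namespace Summit.ValiantsHypothesis.ValiantsHypothesis.Cruxes.DualUnipotentThreeHalves.BlockIndexCore

open MvPolynomial Matrix
open Summit.ValiantsHypothesis.ValiantsHypothesis.Cruxes.TwoDimCoefficients.DimTwoCases (AffMat IsAffine)
open Summit.ValiantsHypothesis.ValiantsHypothesis.Theorems.GrenetZeon.RadicalSplit
open Summit.ValiantsHypothesis.ValiantsHypothesis.Theorems.GrenetZeon.IndexCore
open Summit.ValiantsHypothesis.ValiantsHypothesis.Theorems.GrenetZeon.HeavyTopInvariantFlag (blockUpper_mul)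
open Summit.ValiantsHypothesis.ValiantsHypothesis.Theorems.GrenetZeon.Necklace (word_conj)

variable {m : ℕ}

/-! ## §1 Block-lower matrices whose `a`-th power has vanishing diagonal blocks -/

/-- Powers of a block-lower matrix are block lower. -/
theorem pow_blockLower (lvl : Fin m → ℕ) (Q : Matrix (Fin m) (Fin m) ℂ)
    (hQ : ∀ i j, lvl i < lvl j → Q i j = 0) : ∀ (k : ℕ) (i j : Fin m), lvl i < lvl j → (Q ^ k) i j = 0
  | 0, i, j, hij => by
      rw [pow_zero, Matrix.one_apply, if_neg (fun h => by rw [h] at hij; exact lt_irrefl _ hij)]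
  | k + 1, i, j, hij => by
      rw [pow_succ]; exact blockUpper_mul lvl _ _ (pow_blockLower lvl Q hQ k) hQ i j hij

/-- If `Q` is block lower and the diagonal blocks of `Q^a` vanish, then `Q^a` is STRICTLY block lower. -/
theorem pow_strict_of_diag_pow (lvl : Fin m → ℕ) (Q : Matrix (Fin m) (Fin m) ℂ) (a : ℕ)
    (hQ : ∀ i j, lvl i < lvl j → Q i j = 0) (hQa : ∀ i j, lvl i = lvl j → (Q ^ a) i j = 0) :
    ∀ i j : Fin m, lvl i ≤ lvl j → (Q ^ a) i j = 0 := by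
  intro i j hij
  rcases lt_or_eq_of_le hij with h | h
  · exact pow_blockLower lvl Q hQ a i j h
  · exact hQa i j h

/-- If `Q` is block lower and the diagonal blocks of `Q^a` vanish, then `(Q^(a(t+1)))_{ij} = 0` whenever
`lvl i ≤ lvl j + t`: strictly block-lower matrices lower the level. -/
theorem pow_apply_eq_zero_of_diag_pow (lvl : Fin m → ℕ) (Q : Matrix (Fin m) (Fin m) ℂ) (a : ℕ)
    (hQ : ∀ i j, lvl i < lvl j → Q i j = 0) (hQa : ∀ i j, lvl i = lvl j → (Q ^ a) i j = 0) :
    ∀ (t : ℕ) (i j : Fin m), lvl i ≤ lvl j + t → (Q ^ (a * (t + 1))) i j = 0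
  | 0, i, j, hij => by
      rw [zero_add, mul_one]
      exact pow_strict_of_diag_pow lvl Q a hQ hQa i j (by simpa using hij)
  | t + 1, i, j, hij => by
      have hsplit : a * (t + 1 + 1) = a * (t + 1) + a := by ring
      rw [hsplit, pow_add, Matrix.mul_apply]
      refine Finset.sum_eq_zero fun l _ => ?_
      rcases Nat.lt_or_ge (lvl j) (lvl l) with h | h
      · -- `lvl l ≥ lvl j + 1`, so `lvl i ≤ lvl l + t`: the left factor vanishes
        rw [pow_apply_eq_zero_of_diag_pow lvl Q a hQ hQa t i l (by omega), zero_mul]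
      · -- `lvl l ≤ lvl j`: the right factor `Q^a` vanishes (strictly block lower)
        rw [pow_strict_of_diag_pow lvl Q a hQ hQa l j h, mul_zero]

/-- Nonzero entries of `Q^u` sit below the diagonal blocks by a controlled amount:
`(Q^u)_{ij} ≠ 0 ⇒ lvl j ≤ lvl i ∧ u + 1 ≤ a·((lvl i − lvl j) + 1)`. -/
theorem pow_apply_ne_zero (lvl : Fin m → ℕ) (Q : Matrix (Fin m) (Fin m) ℂ) (a : ℕ)
    (hQ : ∀ i j, lvl i < lvl j → Q i j = 0) (hQa : ∀ i j, lvl i = lvl j → (Q ^ a) i j = 0)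
    (u : ℕ) (i j : Fin m) (h : (Q ^ u) i j ≠ 0) : lvl j ≤ lvl i ∧ u + 1 ≤ a * (lvl i - lvl j + 1) := by
  have hji : lvl j ≤ lvl i := by
    by_contra hlt
    exact h (pow_blockLower lvl Q hQ u i j (lt_of_not_ge hlt))
  refine ⟨hji, ?_⟩
  by_contra hlt
  have hle : a * (lvl i - lvl j + 1) ≤ u := by omega
  apply h
  obtain ⟨s, hs⟩ := Nat.exists_eq_add_of_le hle
  rw [hs, pow_add, Matrix.mul_apply]
  refine Finset.sum_eq_zero fun l _ => ?_
  rcases Nat.lt_or_ge (lvl l) (lvl j) with h' | h'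
  · rw [pow_blockLower lvl Q hQ s l j h', mul_zero]
  · rw [pow_apply_eq_zero_of_diag_pow lvl Q a hQ hQa (lvl i - lvl j) i l (by omega), zero_mul]

/-! ## §2 The word invariant -/

/-- **Word invariant.**  `P, Q` block lower, diagonal blocks of `Q^a` zero:
`(Q^u · word P Q w)_{ij} ≠ 0 ⇒ lvl j ≤ lvl i ∧ #true + u + #false + 1 ≤ a·(#false + (lvl i − lvl j) + 1)`.
(`a`-bounded runs of tops inside a block; each constant letter or level descent opens a new run.) -/
theorem count_le_of_block (lvl : Fin m → ℕ) (P Q : Matrix (Fin m) (Fin m) ℂ) (a : ℕ)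
    (hP : ∀ i j, lvl i < lvl j → P i j = 0) (hQ : ∀ i j, lvl i < lvl j → Q i j = 0)
    (hQa : ∀ i j, lvl i = lvl j → (Q ^ a) i j = 0) :
    ∀ (w : List Bool) (u : ℕ) (i j : Fin m), (Q ^ u * word P Q w) i j ≠ 0 →
      lvl j ≤ lvl i ∧ w.count true + u + w.count false + 1 ≤ a * (w.count false + (lvl i - lvl j) + 1)
  | [], u, i, j, h => by
      have h' : (Q ^ u) i j ≠ 0 := by simpa [word] using h
      obtain ⟨hji, hu⟩ := pow_apply_ne_zero lvl Q a hQ hQa u i j h'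
      simp only [List.count_nil, zero_add, add_zero]
      exact ⟨hji, hu⟩
  | true :: w, u, i, j, h => by
      have h' : (Q ^ (u + 1) * word P Q w) i j ≠ 0 := by
        rwa [word_cons, if_pos rfl, ← Matrix.mul_assoc, ← pow_succ] at h
      obtain ⟨hji, hc⟩ := count_le_of_block lvl P Q a hP hQ hQa w (u + 1) i j h'
      refine ⟨hji, ?_⟩
      simp only [List.count_cons_self]
      have hf : (true :: w).count false = w.count false := by simp
      rw [hf]
      omega
  | false :: w, u, i, j, h => by
      rw [word_cons] at h
      simp only [Bool.false_eq_true, ↓reduceIte] at h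
      rw [← Matrix.mul_assoc, Matrix.mul_apply] at h
      obtain ⟨l, -, hl⟩ := Finset.exists_ne_zero_of_sum_ne_zero h
      have hl1 : (Q ^ u * P) i l ≠ 0 := fun h0 => hl (by rw [h0, zero_mul])
      have hl2 : word P Q w l j ≠ 0 := fun h0 => hl (by rw [h0, mul_zero])
      rw [Matrix.mul_apply] at hl1
      obtain ⟨k, -, hk⟩ := Finset.exists_ne_zero_of_sum_ne_zero hl1
      have hk1 : (Q ^ u) i k ≠ 0 := fun h0 => hk (by rw [h0, zero_mul])
      have hk2 : P k l ≠ 0 := fun h0 => hk (by rw [h0, mul_zero])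
      -- levels along the chain `i ⟵ k ⟵ l ⟵ j`
      obtain ⟨hki, hu⟩ := pow_apply_ne_zero lvl Q a hQ hQa u i k hk1
      have hlk : lvl l ≤ lvl k := by
        by_contra hlt
        exact hk2 (hP k l (lt_of_not_ge hlt))
      obtain ⟨hjl, hw⟩ := count_le_of_block lvl P Q a hP hQ hQa w 0 l j (by rwa [pow_zero, Matrix.one_mul])
      refine ⟨le_trans hjl (le_trans hlk hki), ?_⟩
      have hf : (false :: w).count false = w.count false + 1 := by simp
      have ht : (false :: w).count true = w.count true := by simp
      rw [hf, ht]
      have key : a * (w.count false + (lvl l - lvl j) + 1) + a * (lvl i - lvl k + 1) ≤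
          a * (w.count false + 1 + (lvl i - lvl j) + 1) := by
        rw [← mul_add]
        exact Nat.mul_le_mul_left _ (by omega)
      omega

/-- **Word-tameness from block index cores.**  With `p` levels (`lvl < p`), `1 ≤ a`, `1 ≤ p`: every pair `(P, Q)` as in
`count_le_of_block` is word-tame with profile `c = 1, r = a − 1, Θ = a·p − 1` and budget
`⌊(a·p − 1 + (a−1)(n−1))/a⌋ ≤ k`. -/
theorem wordTame_of_block (lvl : Fin m → ℕ) (p a : ℕ) (hp : 1 ≤ p) (ha : 1 ≤ a) (hlvl : ∀ i, lvl i < p)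
    (P Q : Matrix (Fin m) (Fin m) ℂ)
    (hP : ∀ i j, lvl i < lvl j → P i j = 0) (hQ : ∀ i j, lvl i < lvl j → Q i j = 0)
    (hQa : ∀ i j, lvl i = lvl j → (Q ^ a) i j = 0) {n k : ℕ}
    (hk : (a * p - 1 + (a - 1) * (n - 1)) / a ≤ k) : WordTame n k P Q := by
  refine ⟨a - 1, 1, a * p - 1, le_rfl, ?_, fun w hw => ?_⟩
  · have h1 : 1 + (a - 1) = a := by omega
    rw [h1]; exact hk
  · -- a nonzero word has a nonzero entry
    obtain ⟨i, j, hij⟩ : ∃ i j, word P Q w i j ≠ 0 := by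
      by_contra hall
      push Not at hall
      exact hw (Matrix.ext hall)
    obtain ⟨hji, hc⟩ := count_le_of_block lvl P Q a hP hQ hQa w 0 i j (by rwa [pow_zero, Matrix.one_mul])
    have hΔ : lvl i - lvl j + 1 ≤ p := by have := hlvl i; omega
    have h2 : a * (w.count false + (lvl i - lvl j) + 1) ≤ a * w.count false + a * p := by
      rw [← mul_add]; exact Nat.mul_le_mul_left _ (by omega)
    have h3 : a * w.count false = (a - 1) * w.count false + w.count false := by
      obtain ⟨b, rfl⟩ : ∃ b, a = b + 1 := ⟨a - 1, by omega⟩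
      rw [Nat.add_sub_cancel, Nat.succ_mul]
    have h4 : 1 ≤ a * p := Nat.le_of_lt_succ (by nlinarith)
    omega

/-! ## §3 The certificate for affine pencils -/

/-- Conjugating by a unit reflects non-vanishing of words. -/
theorem word_ne_zero_conj (g : (Matrix (Fin m) (Fin m) ℂ)ˣ) (P Q : Matrix (Fin m) (Fin m) ℂ) (w : List Bool)
    (h : word P Q w ≠ 0) :
    word ((g : Matrix (Fin m) (Fin m) ℂ) * P * ((g⁻¹ : (Matrix (Fin m) (Fin m) ℂ)ˣ) : Matrix (Fin m) (Fin m) ℂ))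
         ((g : Matrix (Fin m) (Fin m) ℂ) * Q * ((g⁻¹ : (Matrix (Fin m) (Fin m) ℂ)ˣ) : Matrix (Fin m) (Fin m) ℂ)) w ≠ 0 := by
  rw [word_conj]
  intro h0
  apply h
  have := congr_arg (fun M => ((g⁻¹ : (Matrix (Fin m) (Fin m) ℂ)ˣ) : Matrix (Fin m) (Fin m) ℂ) * M *
    (g : Matrix (Fin m) (Fin m) ℂ)) h0
  simpa [Matrix.mul_assoc] using this

/-- Evaluating the conjugated pencil: `(g.map C * N * g⁻¹.map C)(x) = g * N(x) * g⁻¹` entrywise. -/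
theorem eval_conj_apply {n : ℕ} (N : AffMat n m) (g : (Matrix (Fin m) (Fin m) ℂ)ˣ) (x : Fin n × Fin n → ℂ)
    (i j : Fin m) :
    MvPolynomial.eval x (((g : Matrix (Fin m) (Fin m) ℂ).map C * N *
        ((g⁻¹ : (Matrix (Fin m) (Fin m) ℂ)ˣ) : Matrix (Fin m) (Fin m) ℂ).map C :
          Matrix (Fin m) (Fin m) (MvPolynomial (Fin n × Fin n) ℂ)) i j) =
      ((g : Matrix (Fin m) (Fin m) ℂ) * N.map (MvPolynomial.eval x) *
        ((g⁻¹ : (Matrix (Fin m) (Fin m) ℂ)ˣ) : Matrix (Fin m) (Fin m) ℂ)) i j := by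
  have h := (RingHom.mapMatrix (MvPolynomial.eval x) : Matrix (Fin m) (Fin m) (MvPolynomial (Fin n × Fin n) ℂ) →+*
    Matrix (Fin m) (Fin m) ℂ).map_mul
  have hC : ∀ A : Matrix (Fin m) (Fin m) ℂ, (A.map C).map (MvPolynomial.eval x) = A := by
    intro A; ext a b; simp
  have : ((((g : Matrix (Fin m) (Fin m) ℂ).map C * N *
        ((g⁻¹ : (Matrix (Fin m) (Fin m) ℂ)ˣ) : Matrix (Fin m) (Fin m) ℂ).map C).map (MvPolynomial.eval x)) i j) =
      ((g : Matrix (Fin m) (Fin m) ℂ) * N.map (MvPolynomial.eval x) *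
        ((g⁻¹ : (Matrix (Fin m) (Fin m) ℂ)ˣ) : Matrix (Fin m) (Fin m) ℂ)) i j := by
    rw [Matrix.map_mul, Matrix.map_mul, hC, hC]
  simpa [Matrix.map_apply] using this

/-- **THE BLOCK INDEX-CORE CERTIFICATE** (G-core for `a = 1`, ★ for `p = 1`).  Let the affine pencil `N` be block lower
after the constant change of basis `g` for the level function `lvl` with `p` levels, let `1 ≤ a`, and let `K` be a
direction space on which the diagonal blocks of `(g N_lin(v) g⁻¹)^a` vanish.  If
`(⌊(a·p − 1 + (a−1)(n−1))/a⌋ + 1)·n < dim K` then `FlagCheap n m N`. [val-idea-26 g5, memo §4.2] -/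
theorem flagCheap_of_block_indexCores {n : ℕ} (N : AffMat n m) (hN : IsAffine N)
    (g : (Matrix (Fin m) (Fin m) ℂ)ˣ) (lvl : Fin m → ℕ) (p : ℕ) (hp : 1 ≤ p) (hlvl : ∀ i, lvl i < p)
    (hblock : ∀ i j : Fin m, lvl i < lvl j →
      ((g : Matrix (Fin m) (Fin m) ℂ).map C * N * ((g⁻¹ : (Matrix (Fin m) (Fin m) ℂ)ˣ) : Matrix (Fin m) (Fin m) ℂ).map C :
        Matrix (Fin m) (Fin m) (MvPolynomial (Fin n × Fin n) ℂ)) i j = 0)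
    (a : ℕ) (ha : 1 ≤ a) (K : Submodule ℂ (Fin n × Fin n → ℂ))
    (hK : ∀ v ∈ K, ∀ i j : Fin m, lvl i = lvl j →
      (((g : Matrix (Fin m) (Fin m) ℂ) * linPart N v * ((g⁻¹ : (Matrix (Fin m) (Fin m) ℂ)ˣ) : Matrix (Fin m) (Fin m) ℂ)) ^ a)
        i j = 0)
    (hdim : ((a * p - 1 + (a - 1) * (n - 1)) / a + 1) * n < Module.finrank ℂ K) :
    FlagCheap n m N := by
  refine (flagCheap_iff_wordCheap N hN).2 ⟨K, (a * p - 1 + (a - 1) * (n - 1)) / a, hdim, fun x v hv => ?_⟩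
  -- block-lower conjugates of the constant part and of the top
  have hconst : ∀ y : Fin n × Fin n → ℂ, ∀ i j : Fin m, lvl i < lvl j →
      ((g : Matrix (Fin m) (Fin m) ℂ) * N.map (MvPolynomial.eval y) *
        ((g⁻¹ : (Matrix (Fin m) (Fin m) ℂ)ˣ) : Matrix (Fin m) (Fin m) ℂ)) i j = 0 := by
    intro y i j hij
    rw [← eval_conj_apply N g y i j, hblock i j hij, map_zero]
  set P₀ := (g : Matrix (Fin m) (Fin m) ℂ) * N.map (MvPolynomial.eval x) *
    ((g⁻¹ : (Matrix (Fin m) (Fin m) ℂ)ˣ) : Matrix (Fin m) (Fin m) ℂ) with hP₀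
  set Q := (g : Matrix (Fin m) (Fin m) ℂ) * linPart N v *
    ((g⁻¹ : (Matrix (Fin m) (Fin m) ℂ)ˣ) : Matrix (Fin m) (Fin m) ℂ) with hQdef
  have hP : ∀ i j, lvl i < lvl j → P₀ i j = 0 := hconst x
  have hQ : ∀ i j, lvl i < lvl j → Q i j = 0 := by
    intro i j hij
    rw [hQdef, linPart, Matrix.mul_sub, Matrix.sub_mul, Matrix.sub_apply, hconst v i j hij, hconst 0 i j hij, sub_zero]
  have hT := wordTame_of_block lvl p a hp ha hlvl P₀ Q hP hQ (hK v hv) (n := n) le_rfl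
  -- transport word-tameness back along the conjugation
  obtain ⟨r, c, Θ, hc, hk, hw⟩ := hT
  exact ⟨r, c, Θ, hc, hk, fun w hne => hw w (by rw [hP₀, hQdef]; exact word_ne_zero_conj g _ _ w hne)⟩

/-- Sanity: `a = 1` is G-core's budget `p − 1`, `p = 1` is ★'s budget `⌊(a−1)n/a⌋`. -/
example (p n : ℕ) : (1 * p - 1 + (1 - 1) * (n - 1)) / 1 = p - 1 := by simp
example (a n : ℕ) (ha : 1 ≤ a) : (a * 1 - 1 + (a - 1) * (n - 1)) / a = (a - 1) * n / a := by
  obtain ⟨b, rfl⟩ : ∃ b, a = b + 1 := ⟨a - 1, by omega⟩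
  rcases n with _ | n
  · simp
  · congr 1
    simp [Nat.mul_succ]; ring

/-! ## §4 The necessary half of the index sandwich (memo §1) -/

/-- **FLAG-CHEAP ⇒ INDEX-NECESSARY** — the BY-NAME form (over `FlagCheap` / `linPart`) of ✓ p613488
`FlagCheapIndexBound.linPart_pow_eq_zero_of_flagCheap` (which states the same over the unfolded flag predicate and the coefficient
matrix): if an affine pencil is flag-cheap then some direction space `K` with `a·n < dim K` carries only tops of nilindex `≤ a`
(`a = k + 1` for the flag budget `k`; `k + 2 ≤ n` is automatic from `(k+1)·n < dim K ≤ n²`; ✓ `RadicalSplit.pow_eq_zero_of_wordTame`).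
Contrapositive = the shape of ✓ `IndexSparseKill.not_flagCheap_of_indexSparse`.  Nothing new; packaged for the sandwich with ★.
[p613488 restated; val-idea-26 g5, memo §1] -/
theorem indexNec_of_flagCheap {n : ℕ} (N : AffMat n m) (hN : IsAffine N) (h : FlagCheap n m N) :
    ∃ (K : Submodule ℂ (Fin n × Fin n → ℂ)) (a : ℕ), 1 ≤ a ∧ (∀ v ∈ K, linPart N v ^ a = 0) ∧
      a * n < Module.finrank ℂ K := by
  obtain ⟨K, k, hdim, hw⟩ := (flagCheap_iff_wordCheap N hN).1 h
  have hKle : Module.finrank ℂ K ≤ n * n := by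
    calc Module.finrank ℂ K ≤ Module.finrank ℂ (Fin n × Fin n → ℂ) := Submodule.finrank_le K
      _ = n * n := by rw [Module.finrank_pi, Fintype.card_prod, Fintype.card_fin]
  have hkn : k + 2 ≤ n := by
    by_contra hlt
    have h1 : n * n ≤ (k + 1) * n := Nat.mul_le_mul_right _ (by omega)
    omega
  exact ⟨K, k + 1, by omega, fun v hv => pow_eq_zero_of_wordTame hkn _ _ (hw 0 v hv), hdim⟩

end Summit.ValiantsHypothesis.ValiantsHypothesis.Cruxes.DualUnipotentThreeHalves.BlockIndexCore
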